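import Summits.Ventures.DiscreteObjects.PP12.FanoFiveReduction
import Summits.Ventures.DiscreteObjects.PP12.FanoFiveIncMatrix

/-!
# PP(12), order 5: the orbit-matrix reduction WITH the incidence of the fixed Fano subplane holds (kernel)
Framing: lottery ticket; floor = certified bounds/negative ranges.

Cell pub-namedobj (venture DiscreteObjects), target (M), designs gen 15. `fanoFiveIncReduction_holds : FanoFiveIncReduction` (`FanoFiveIncMatrix`):
the orbit matrix `fanoMat5` read off a projective plane of order 12 with a collineation `σ ≠ 1`, `σ⁵ = 1` (`FanoFiveReduction`, plain part
`isFanoFiveOrbitMatrix_ofPlane`) satisfies, together with the incidence `fanoInc5 x μ :⇔ x ∈ μ` of the fixed Fano subplane in the labels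
`e7P`, `e7L` (`FanoFiveIndexSets`), the four tangent-block systems: a non-fixed line through the fixed point `x` meets the fixed line `μ` in a
non-fixed point iff `x ∉ μ` (`fanoMat5_tangent_block_row/col`), and an exterior line (point) meets every fixed line (is joined to every fixed
point) by exactly one non-fixed point (line) (`fanoMat5_exterior_row_block`, `fanoMat5_exterior_col_block`); `fanoInc5` is a labelled Fano plane
(`isIncidence_fanoInc5`, from `OrderFive.fano_of_pow_five`). Census consequence `noOrderFive_of_noFanoFiveIncMatrix` (pure logic; the orbit level
`NoFanoFiveIncMatrix` is decided EMPTY only outside the kernel, designs g10). Tool: orbits inside a stable set partition it (`sum_image_orbP_card_filter`).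
No `sorry`, no new axioms.
-/

namespace Summit.Ventures.DiscreteObjects.PP12

open Configuration Finset
open scoped Classical

section Perm

variable {α : Type*}

/-- **Orbits inside a stable set partition it:** summing `|O ∩ Q|` over the orbits of the elements of a `τ`-stable finset `S` counts `S ∩ Q`
(`τ ^ p = 1`, `p > 0`). -/
theorem sum_image_orbP_card_filter (τ : Equiv.Perm α) {p : ℕ} (h : τ ^ p = 1) (hp : 0 < p) (S : Finset α) (hS : ∀ x ∈ S, τ x ∈ S)
    (Q : α → Prop) : ∑ O ∈ S.image (orbP τ p), (O.filter Q).card = (S.filter Q).card := by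
  have himg : ∀ q ∈ S.filter Q, orbP τ p q ∈ S.image (orbP τ p) := fun q hq =>
    mem_image.2 ⟨q, (mem_filter.1 hq).1, rfl⟩
  rw [Finset.card_eq_sum_card_fiberwise himg]
  refine Finset.sum_congr rfl fun O hO => ?_
  obtain ⟨x, hx, rfl⟩ := mem_image.1 hO
  congr 1
  ext q
  simp only [mem_filter]
  constructor
  · rintro ⟨hqx, hQ⟩
    exact ⟨⟨orbP_subset_of_stable τ p S hS hx hqx, hQ⟩, orbP_eq_of_mem _ h hp hqx⟩
  · rintro ⟨⟨-, hQ⟩, he⟩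
    exact ⟨by rw [← he]; exact self_mem_orbP _ hp _, hQ⟩

end Perm

namespace Collineation

variable {P L : Type*} [Membership P L] [ProjectivePlane P L] [Fintype P] [Fintype L] (σ : Collineation P L)
variable (h12 : ProjectivePlane.order P L = 12) (hne : σ.onPoints ≠ 1) (hq : σ.onPoints ^ 5 = 1)

/-- **The incidence of the fixed Fano subplane** in the labels `e7P` (fixed points) and `e7L` (fixed lines). -/
noncomputable def fanoInc5 (x μ : Fin 7) : Bool := decide ((σ.e7P h12 hne hq x).1 ∈ (σ.e7L h12 hne hq μ).1)

/-- Unfolding `fanoInc5`. -/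
theorem fanoInc5_eq_true_iff (x μ : Fin 7) : σ.fanoInc5 h12 hne hq x μ = true ↔ (σ.e7P h12 hne hq x).1 ∈ (σ.e7L h12 hne hq μ).1 := by
  unfold fanoInc5; exact decide_eq_true_iff

/-! ### `fanoInc5` is a labelled Fano plane -/

/-- Every fixed point lies on `3` fixed lines. -/
theorem fanoInc5_point (x : Fin 7) : (univ.filter fun μ : Fin 7 => σ.fanoInc5 h12 hne hq x μ = true).card = 3 := by
  have h3 : σ.fixedThrough (σ.e7P h12 hne hq x).1 = 3 := (σ.fano_of_pow_five h12 hne hq).2.2.2 _ (σ.e7P h12 hne hq x).2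
  rw [← h3]
  unfold fixedThrough
  refine Finset.card_bij (fun μ _ => (σ.e7L h12 hne hq μ).1) (fun μ hμ => ?_) (fun μ₁ _ μ₂ _ h => ?_) (fun m hm => ?_)
  · rw [mem_filter] at hμ ⊢
    exact ⟨mem_univ _, (σ.fanoInc5_eq_true_iff h12 hne hq x μ).1 hμ.2, (σ.e7L h12 hne hq μ).2⟩
  · exact (σ.e7L h12 hne hq).injective (Subtype.ext h)
  · rw [mem_filter] at hm
    refine ⟨(σ.e7L h12 hne hq).symm ⟨m, hm.2.2⟩, ?_, by rw [Equiv.apply_symm_apply]⟩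
    rw [mem_filter, fanoInc5_eq_true_iff, Equiv.apply_symm_apply]
    exact ⟨mem_univ _, hm.2.1⟩

/-- Every fixed line carries `3` fixed points. -/
theorem fanoInc5_line (μ : Fin 7) : (univ.filter fun x : Fin 7 => σ.fanoInc5 h12 hne hq x μ = true).card = 3 := by
  have h3 : σ.fixedOnLine (σ.e7L h12 hne hq μ).1 = 3 := (σ.fano_of_pow_five h12 hne hq).2.2.1 _ (σ.e7L h12 hne hq μ).2
  rw [← h3]
  unfold fixedOnLine
  refine Finset.card_bij (fun x _ => (σ.e7P h12 hne hq x).1) (fun x hx => ?_) (fun x₁ _ x₂ _ h => ?_) (fun q hq' => ?_)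
  · rw [mem_filter] at hx ⊢
    exact ⟨mem_univ _, (σ.fanoInc5_eq_true_iff h12 hne hq x μ).1 hx.2, (σ.e7P h12 hne hq x).2⟩
  · exact (σ.e7P h12 hne hq).injective (Subtype.ext h)
  · rw [mem_filter] at hq'
    refine ⟨(σ.e7P h12 hne hq).symm ⟨q, hq'.2.2⟩, ?_, by rw [Equiv.apply_symm_apply]⟩
    rw [mem_filter, fanoInc5_eq_true_iff, Equiv.apply_symm_apply]
    exact ⟨mem_univ _, hq'.2.1⟩

/-- Two distinct fixed points lie on exactly one common fixed line (their joining line is fixed). -/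
theorem fanoInc5_two_points (x x' : Fin 7) (hxx : x ≠ x') :
    (univ.filter fun μ : Fin 7 => σ.fanoInc5 h12 hne hq x μ = true ∧ σ.fanoInc5 h12 hne hq x' μ = true).card = 1 := by
  have hpp : (σ.e7P h12 hne hq x).1 ≠ (σ.e7P h12 hne hq x').1 := fun h => hxx ((σ.e7P h12 hne hq).injective (Subtype.ext h))
  obtain ⟨h1, h2⟩ := HasLines.mkLine_ax (L := L) hpp
  have hfix : σ.onLines (HasLines.mkLine hpp : L) = HasLines.mkLine hpp :=
    σ.line_fixed_of_two_fixed h1 h2 hpp (σ.e7P h12 hne hq x).2 (σ.e7P h12 hne hq x').2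
  rw [card_eq_one]
  refine ⟨(σ.e7L h12 hne hq).symm ⟨HasLines.mkLine hpp, hfix⟩, ?_⟩
  ext μ
  rw [mem_filter, mem_singleton, fanoInc5_eq_true_iff, fanoInc5_eq_true_iff]
  constructor
  · rintro ⟨-, hμ1, hμ2⟩
    have hm : (σ.e7L h12 hne hq μ).1 = HasLines.mkLine hpp := (Nondegenerate.eq_or_eq hμ1 hμ2 h1 h2).resolve_left hpp
    rw [Equiv.eq_symm_apply]
    exact Subtype.ext hm
  · rintro rfl
    rw [Equiv.apply_symm_apply]
    exact ⟨mem_univ _, h1, h2⟩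

/-- **`fanoInc5` is a labelled Fano plane.** -/
theorem isIncidence_fanoInc5 : FanoFive.IsIncidence (σ.fanoInc5 h12 hne hq) :=
  ⟨σ.fanoInc5_point h12 hne hq, σ.fanoInc5_line h12 hne hq, σ.fanoInc5_two_points h12 hne hq⟩

/-! ### The tangent blocks -/

/-- The non-fixed points of a fixed line form a `σ`-stable set. -/
theorem tangentPoints_stable (μ : Fin 7) :
    ∀ y ∈ (univ.filter fun y : P => y ∈ (σ.e7L h12 hne hq μ).1 ∧ σ.onPoints y ≠ y),
      σ.onPoints y ∈ (univ.filter fun y : P => y ∈ (σ.e7L h12 hne hq μ).1 ∧ σ.onPoints y ≠ y) := by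
  intro y hy
  rw [mem_filter] at hy ⊢
  exact ⟨mem_univ _, (σ.mem_fixedLine_iff (σ.e7L h12 hne hq μ).2 y).2 hy.2.1, fun h => hy.2.2 (σ.onPoints.injective h)⟩

/-- The non-fixed lines through a fixed point form a `σ`-stable set. -/
theorem tangentLines_stable (x : Fin 7) :
    ∀ m ∈ (univ.filter fun m : L => (σ.e7P h12 hne hq x).1 ∈ m ∧ σ.onLines m ≠ m),
      σ.onLines m ∈ (univ.filter fun m : L => (σ.e7P h12 hne hq x).1 ∈ m ∧ σ.onLines m ≠ m) := by
  intro m hm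
  rw [mem_filter] at hm ⊢
  refine ⟨mem_univ _, ?_, fun h => hm.2.2 (σ.onLines.injective h)⟩
  have := σ.mem_map hm.2.1
  rwa [(σ.e7P h12 hne hq x).2] at this

/-- Summing a function over the two tangent-point columns of the fixed line `μ` = summing it over the orbits of the non-fixed points of `μ`. -/
theorem sum_tangent_cols (μ : Fin 7) (g : Finset P → ℕ) :
    ∑ b : Fin 2, g (σ.colOrbit5 h12 hne hq (Sum.inl (μ, b))) =
      ∑ O ∈ (univ.filter fun y : P => y ∈ (σ.e7L h12 hne hq μ).1 ∧ σ.onPoints y ≠ y).image (orbP σ.onPoints 5), g O := by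
  change ∑ b : Fin 2, g (σ.eTP h12 hne hq (σ.e7L h12 hne hq μ) b).1 = _
  rw [(σ.eTP h12 hne hq (σ.e7L h12 hne hq μ)).sum_comp (fun O => g O.1)]
  exact Finset.sum_coe_sort _ g

/-- Summing a function over the two tangent-line rows of the fixed point `x` = summing it over the orbits of the non-fixed lines through `x`. -/
theorem sum_tangent_rows (x : Fin 7) (g : Finset L → ℕ) :
    ∑ a : Fin 2, g (σ.rowOrbit5 h12 hne hq (Sum.inl (x, a))) =
      ∑ B ∈ (univ.filter fun m : L => (σ.e7P h12 hne hq x).1 ∈ m ∧ σ.onLines m ≠ m).image (orbP σ.onLines 5), g B := by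
  change ∑ a : Fin 2, g (σ.eTL h12 hne hq (σ.e7P h12 hne hq x) a).1 = _
  rw [(σ.eTL h12 hne hq (σ.e7P h12 hne hq x)).sum_comp (fun B => g B.1)]
  exact Finset.sum_coe_sort _ g

/-- **Tangent block, rows:** a line of the tangent row `(x, a)` meets the fixed line `μ` in a non-fixed point iff `x ∉ μ`. -/
theorem fanoMat5_tangent_block_row (x : Fin 7) (a : Fin 2) (μ : Fin 7) :
    ∑ b : Fin 2, σ.fanoMat5 h12 hne hq (Sum.inl (x, a)) (Sum.inl (μ, b)) = if σ.fanoInc5 h12 hne hq x μ then 0 else 1 := by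
  obtain ⟨hnℓ, -, hxℓ⟩ := σ.lineRep5_spec h12 hne hq (Sum.inl (x, a))
  set ℓ := σ.lineRep5 h12 hne hq (Sum.inl (x, a)) with hℓ
  change (σ.e7P h12 hne hq x).1 ∈ ℓ at hxℓ
  have hsum := σ.sum_tangent_cols h12 hne hq μ (fun O => (O.filter fun q => q ∈ ℓ).card)
  unfold fanoMat5
  rw [hsum, sum_image_orbP_card_filter σ.onPoints hq (by norm_num) _ (σ.tangentPoints_stable h12 hne hq μ) (fun q => q ∈ ℓ)]
  have hℓμ : ℓ ≠ (σ.e7L h12 hne hq μ).1 := fun h => hnℓ (by rw [h]; exact (σ.e7L h12 hne hq μ).2)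
  by_cases hI : (σ.e7P h12 hne hq x).1 ∈ (σ.e7L h12 hne hq μ).1
  · rw [if_pos ((σ.fanoInc5_eq_true_iff h12 hne hq x μ).2 hI), card_eq_zero, filter_eq_empty_iff]
    intro q hq' hqℓ
    rw [mem_filter] at hq'
    have hqx : q = (σ.e7P h12 hne hq x).1 := (Nondegenerate.eq_or_eq hqℓ hxℓ hq'.2.1 hI).resolve_right hℓμ
    exact hq'.2.2 (by rw [hqx]; exact (σ.e7P h12 hne hq x).2)
  · rw [if_neg (fun h => hI ((σ.fanoInc5_eq_true_iff h12 hne hq x μ).1 h)), card_eq_one]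
    obtain ⟨h0ℓ, h0μ⟩ := HasPoints.mkPoint_ax (P := P) hℓμ
    refine ⟨HasPoints.mkPoint hℓμ, ?_⟩
    ext q
    rw [mem_filter, mem_filter, mem_singleton]
    constructor
    · rintro ⟨⟨-, hqμ, -⟩, hqℓ⟩
      exact (Nondegenerate.eq_or_eq hqℓ h0ℓ hqμ h0μ).resolve_right hℓμ
    · rintro rfl
      refine ⟨⟨mem_univ _, h0μ, fun hfix => hnℓ ?_⟩, h0ℓ⟩
      exact σ.line_fixed_of_two_fixed h0ℓ hxℓ (fun h => hI (by rw [← h]; exact h0μ)) hfix (σ.e7P h12 hne hq x).2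

/-- **Exterior rows vs tangent columns:** an exterior line meets every fixed line in exactly one (non-fixed) point. -/
theorem fanoMat5_exterior_row_block (e : Fin 16) (μ : Fin 7) :
    ∑ b : Fin 2, σ.fanoMat5 h12 hne hq (Sum.inr e) (Sum.inl (μ, b)) = 1 := by
  obtain ⟨hnℓ, -, hfix⟩ := σ.lineRep5_spec h12 hne hq (Sum.inr e)
  set ℓ := σ.lineRep5 h12 hne hq (Sum.inr e) with hℓ
  change ∀ y : P, σ.onPoints y = y → y ∉ ℓ at hfix
  have hsum := σ.sum_tangent_cols h12 hne hq μ (fun O => (O.filter fun q => q ∈ ℓ).card)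
  unfold fanoMat5
  rw [hsum, sum_image_orbP_card_filter σ.onPoints hq (by norm_num) _ (σ.tangentPoints_stable h12 hne hq μ) (fun q => q ∈ ℓ),
    card_eq_one]
  have hℓμ : ℓ ≠ (σ.e7L h12 hne hq μ).1 := fun h => hnℓ (by rw [h]; exact (σ.e7L h12 hne hq μ).2)
  obtain ⟨h0ℓ, h0μ⟩ := HasPoints.mkPoint_ax (P := P) hℓμ
  refine ⟨HasPoints.mkPoint hℓμ, ?_⟩
  ext q
  rw [mem_filter, mem_filter, mem_singleton]
  constructor
  · rintro ⟨⟨-, hqμ, -⟩, hqℓ⟩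
    exact (Nondegenerate.eq_or_eq hqℓ h0ℓ hqμ h0μ).resolve_right hℓμ
  · rintro rfl
    exact ⟨⟨mem_univ _, h0μ, fun hfx => hfix _ hfx h0ℓ⟩, h0ℓ⟩

/-- **Tangent block, columns:** a point of the tangent column `(μ, b)` is joined to the fixed point `x` by a non-fixed line iff `x ∉ μ`. -/
theorem fanoMat5_tangent_block_col (μ : Fin 7) (b : Fin 2) (x : Fin 7) :
    ∑ a : Fin 2, σ.fanoMat5 h12 hne hq (Sum.inl (x, a)) (Sum.inl (μ, b)) = if σ.fanoInc5 h12 hne hq x μ then 0 else 1 := by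
  simp_rw [σ.fanoMat5_eq_card_lines h12 hne hq]
  obtain ⟨hnq, -, hqμ⟩ := σ.pointRep5_spec h12 hne hq (Sum.inl (μ, b))
  set q := σ.pointRep5 h12 hne hq (Sum.inl (μ, b)) with hqdef
  change q ∈ (σ.e7L h12 hne hq μ).1 at hqμ
  have hqL : σ.onLines ^ 5 = 1 := σ.onLines_pow_eq_one hq
  rw [σ.sum_tangent_rows h12 hne hq x (fun B => (B.filter fun m => q ∈ m).card),
    sum_image_orbP_card_filter σ.onLines hqL (by norm_num) _ (σ.tangentLines_stable h12 hne hq x) (fun m => q ∈ m)]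
  have hpq : (σ.e7P h12 hne hq x).1 ≠ q := fun h => hnq (by rw [← h]; exact (σ.e7P h12 hne hq x).2)
  by_cases hI : (σ.e7P h12 hne hq x).1 ∈ (σ.e7L h12 hne hq μ).1
  · rw [if_pos ((σ.fanoInc5_eq_true_iff h12 hne hq x μ).2 hI), card_eq_zero, filter_eq_empty_iff]
    intro m hm hqm
    rw [mem_filter] at hm
    have hmμ : m = (σ.e7L h12 hne hq μ).1 := (Nondegenerate.eq_or_eq hm.2.1 hqm hI hqμ).resolve_left hpq
    exact hm.2.2 (by rw [hmμ]; exact (σ.e7L h12 hne hq μ).2)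
  · rw [if_neg (fun h => hI ((σ.fanoInc5_eq_true_iff h12 hne hq x μ).1 h)), card_eq_one]
    obtain ⟨hXm, hqm⟩ := HasLines.mkLine_ax (L := L) hpq
    refine ⟨HasLines.mkLine hpq, ?_⟩
    ext m
    rw [mem_filter, mem_filter, mem_singleton]
    constructor
    · rintro ⟨⟨-, hXm', -⟩, hqm'⟩
      exact (Nondegenerate.eq_or_eq hXm' hqm' hXm hqm).resolve_left hpq
    · rintro rfl
      refine ⟨⟨mem_univ _, hXm, fun hfm => hnq ?_⟩, hqm⟩
      have hmμ : (HasLines.mkLine hpq : L) ≠ (σ.e7L h12 hne hq μ).1 := fun h => hI (by rw [← h]; exact hXm)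
      exact σ.point_fixed_of_two_fixed hqm hqμ hmμ hfm (σ.e7L h12 hne hq μ).2

/-- **Exterior columns vs tangent rows:** an exterior point is joined to every fixed point by exactly one (non-fixed) line. -/
theorem fanoMat5_exterior_col_block (e : Fin 16) (x : Fin 7) :
    ∑ a : Fin 2, σ.fanoMat5 h12 hne hq (Sum.inl (x, a)) (Sum.inr e) = 1 := by
  simp_rw [σ.fanoMat5_eq_card_lines h12 hne hq]
  obtain ⟨hnq, -, hql⟩ := σ.pointRep5_spec h12 hne hq (Sum.inr e)
  set q := σ.pointRep5 h12 hne hq (Sum.inr e) with hqdef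
  change ∀ l : L, σ.onLines l = l → q ∉ l at hql
  have hqL : σ.onLines ^ 5 = 1 := σ.onLines_pow_eq_one hq
  rw [σ.sum_tangent_rows h12 hne hq x (fun B => (B.filter fun m => q ∈ m).card),
    sum_image_orbP_card_filter σ.onLines hqL (by norm_num) _ (σ.tangentLines_stable h12 hne hq x) (fun m => q ∈ m), card_eq_one]
  have hpq : (σ.e7P h12 hne hq x).1 ≠ q := fun h => hnq (by rw [← h]; exact (σ.e7P h12 hne hq x).2)
  obtain ⟨hXm, hqm⟩ := HasLines.mkLine_ax (L := L) hpq
  refine ⟨HasLines.mkLine hpq, ?_⟩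
  ext m
  rw [mem_filter, mem_filter, mem_singleton]
  constructor
  · rintro ⟨⟨-, hXm', -⟩, hqm'⟩
    exact (Nondegenerate.eq_or_eq hXm' hqm' hXm hqm).resolve_left hpq
  · rintro rfl
    exact ⟨⟨mem_univ _, hXm, fun hfm => hql _ hfm hqm⟩, hqm⟩

/-- **All conjuncts:** the orbit matrix and the fixed subplane's incidence read off the plane satisfy `IsFanoFiveIncMatrix`. -/
theorem isFanoFiveIncMatrix_ofPlane : IsFanoFiveIncMatrix (σ.fanoInc5 h12 hne hq) (σ.fanoMat5 h12 hne hq) :=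
  ⟨σ.isFanoFiveOrbitMatrix_ofPlane h12 hne hq, σ.fanoMat5_tangent_block_row h12 hne hq, σ.fanoMat5_exterior_row_block h12 hne hq,
    σ.fanoMat5_tangent_block_col h12 hne hq, σ.fanoMat5_exterior_col_block h12 hne hq⟩

end Collineation

/-- **The orbit-matrix reduction of the order-5 cell, with the fixed subplane's incidence, holds** (designs g15's typed statement
`FanoFiveIncReduction` is a theorem). -/
theorem fanoFiveIncReduction_holds : FanoFiveIncReduction := by
  intro P L _ _ _ _ h12 σ hq hne
  exact ⟨_, _, σ.isIncidence_fanoInc5 h12 hne hq, σ.isFanoFiveIncMatrix_ofPlane h12 hne hq⟩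

/-- **Census consequence (pure logic):** if no labelled Fano incidence admits an orbit matrix (`NoFanoFiveIncMatrix` — decided EMPTY only outside the
kernel, designs g10, 2026-08-22), then no projective plane of order 12 has a collineation of order 5 (in print: Janko–van Trung 1982). -/
theorem noOrderFive_of_noFanoFiveIncMatrix (hno : NoFanoFiveIncMatrix) : NoOrderFiveOrder12 :=
  noOrderFive_of_fanoFiveIncReduction fanoFiveIncReduction_holds hno

end Summit.Ventures.DiscreteObjects.PP12
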